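import Summits.PneNP.Statement
import Summits.PneNP.PneNP.Theses.ExpanderLinearGenerators
import Summits.PneNP.PneNP.Theses.ProofCplx
import Summits.PneNP.PneNP.Theorems.ProofCplxProofcplxGeneratorImpliesNPNeCoNP
import Summits.PneNP.PneNP.Theorems.ExpanderLinearGeneratorsNoPolyBoundedProofSystem
import Summits.PneNP.PneNP.Theorems.ExpanderLinearGeneratorsTautBridge
import Literature.Computability.Complexity.PHCollapseNP
import Literature.Computability.Complexity.ProofComplexityNPProofs
import Literature.Computability.MetaComplexity.TextbookFregeCompleteness
import Literature.Computability.Complexity.CookLevinSAT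
import Literature.Computability.Complexity.NegCNFTranscoder
import Literature.Computability.Complexity.NPClosureProofs
import Literature.Computability.MetaComplexity.GeneratorHardnessCriterion

/-!
# Route ExpanderLinearGenerators — the position of the target `NoPolyBoundedProofSystem` (stmt-PneNP-0097)

Helper file (`--supports stmt-PneNP-0097`) for the rank-0 target
`X := Summit.PneNP.PneNP.Theses.ExpanderLinearGenerators.NoPolyBoundedProofSystem`
(`¬ HasPolyBoundedProofSystem TAUT`, shared verbatim by the routes ProofCplx, AperiodicTorus,
LyapunovRefutations, MatroidTseitin). `X` is the open problem `NP ≠ coNP` (kernel-checked `Iff`,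
`noPolyBoundedProofSystem_iff_NP_ne_coNP`); this file records, with no named fact left as a
hypothesis, where `X` sits between the standard conjectures of the tree:

* ABOVE `X` (each implies `X`):
  - Krajíček's generator conjecture (route ProofCplx crux #2, `ProofcplxKrajicekGenerator`:
    a polynomial-time one-bit-stretching `g` whose range meets every infinite `NP` set) —
    `noPolyBoundedProofSystem_of_krajicekGenerator`, through the landed item
    `proofcplx_generatorImpliesNPNeCoNP_proof` (stmt-PneNP-0114);
  - non-collapse of the polynomial hierarchy to `NP`: `PH ≠ NP`, or `Σₖᵖ ≠ NP` / `Πₖᵖ ≠ NP` for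
    any `k ≥ 1` (Stockmeyer 1976; Arora–Barak Thm. 5.4, tree: `PH_eq_NP_of_NP_eq_coNP`) —
    `noPolyBoundedProofSystem_of_PH_ne_NP`, `…_of_SigmaP_ne_NP`, `…_of_PiP_ne_NP`;
    also `Σₖᵖ ≠ Πₖᵖ`, `PH ≠ Σₖᵖ` (`k ≥ 1`);
  - a one-bit-stretching `g ∈ FP` hard for ALL proof systems (Krajíček 2019 Lemma 19.4.1 in
    language form, tree: `range_hits_NP_iff_finite_short_proofs`) — the same crux #2;
  - (elsewhere: `NSETH`, `noPolyBoundedProofSystem_of_nseth`.)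
* BELOW `X` (consequences of `X`):
  - `PH = NP` fails to be refutable from `¬X`: `¬X → PH = NP` (`PH_eq_NP_of_not_noPolyBoundedProofSystem`);
  - super-polynomial Frege lower bounds (route ProofCplx crux #3, `ProofcplxFregeNotPbounded`) —
    `proofcplxFregeNotPbounded_of_noPolyBoundedProofSystem`, by Cook–Reckhow Prop. 1.1 with
    Cor. 2.4 (tree: `NP_eq_coNP_of_isPolyBounded_holds`); in particular `textbookFrege` is not
    polynomially bounded;
  - the summit `PneNP` (`tautBridge_proof`).

So the ProofCplx ladder reads, kernel-checked: crux #2 ⇒ X ⇒ crux #3, and X ⇒ `P ≠ NP`.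
A last section lists equivalent forms of `X`: `coNP ⊄ NP`, `NP ⊄ coNP`, `∃ L ∈ NP \ coNP`,
`SAT ∉ coNP` (Cook–Levin), and "no Cook–Reckhow proof system for `TAUT` is polynomially bounded"
(`TAUT ∉ NP` is `noPolyBoundedProofSystem_iff_TAUT_not_mem_NP` of the companion file).

Sources: S. A. Cook, R. A. Reckhow, J. Symb. Logic 44 (1979) §1–2; L. J. Stockmeyer, TCS 3 (1976)
§3; S. Arora, B. Barak, *Computational Complexity* (2009) Thm. 5.4; J. Krajíček, arXiv:2208.11642 §1.
Prover prover-PneNP-route-PneNP-ExpanderLinearGenerators-3, 2026-08-16.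
-/

set_option linter.dupNamespace false -- `Summit.PneNP.PneNP.…`: summit = sub-problem name (D-0017 single-conjunct layout)

namespace Summit.PneNP.PneNP.Theorems

open Literature.Computability.Complexity Literature.Computability.MetaComplexity
open Summit.PneNP.PneNP.Theses

/-! ### Hypotheses above `X` -/

/-- `NP ≠ coNP` gives the target (one direction of `noPolyBoundedProofSystem_iff_NP_ne_coNP`).
[cite: CookReckhow1979, §1 Prop. 1.1] -/
theorem noPolyBoundedProofSystem_of_NP_ne_coNP (h : Nondeterministic.NP ≠ coNP) :
    ExpanderLinearGenerators.NoPolyBoundedProofSystem :=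
  noPolyBoundedProofSystem_iff_NP_ne_coNP.2 h

/-- A polynomial-time one-bit-stretching map whose range meets every infinite `NP` language
gives the target (through `NP_ne_coNP_of_stretching_generator`). [cite: Krajicek2022, §1 (p. 4)] -/
theorem noPolyBoundedProofSystem_of_stretching_generator {g : List Bool → List Bool} (hg : g ∈ FP)
    (hlen : ∀ x, (g x).length = x.length + 1)
    (hhit : ∀ L ∈ Nondeterministic.NP, L.Infinite → ∃ x, g x ∈ L) :
    ExpanderLinearGenerators.NoPolyBoundedProofSystem :=
  noPolyBoundedProofSystem_of_NP_ne_coNP (NP_ne_coNP_of_stretching_generator hg hlen hhit)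

/-- **Crux #2 of route ProofCplx implies the target**: Krajíček's generator conjecture
`ProofcplxKrajicekGenerator` (stmt-PneNP-0111) gives `NoPolyBoundedProofSystem` (stmt-PneNP-0097),
via the landed support item `proofcplx_generatorImpliesNPNeCoNP_proof` (stmt-PneNP-0114) and
Cook–Reckhow. [cite: Krajicek2022, §1 (p. 4)] -/
theorem noPolyBoundedProofSystem_of_krajicekGenerator (h : ProofCplx.ProofcplxKrajicekGenerator) :
    ExpanderLinearGenerators.NoPolyBoundedProofSystem :=
  noPolyBoundedProofSystem_of_NP_ne_coNP (proofcplx_generatorImpliesNPNeCoNP_proof h)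

/-- **Non-collapse of `PH` to `NP` implies the target**: if `PH ≠ NP` then `TAUT` has no
polynomially bounded proof system (Stockmeyer's collapse `NP = coNP → PH = NP`, tree:
`PH_eq_NP_of_NP_eq_coNP`, with Cook–Reckhow). [cite: AroraBarakCC2009, Thm. 5.4] -/
theorem noPolyBoundedProofSystem_of_PH_ne_NP (h : PH ≠ Nondeterministic.NP) :
    ExpanderLinearGenerators.NoPolyBoundedProofSystem :=
  noPolyBoundedProofSystem_of_NP_ne_coNP (NP_ne_coNP_of_PH_ne_NP h)

/-- If some level `Σₖᵖ` (`k ≥ 1`) of the polynomial hierarchy differs from `NP`, the target holds.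
[cite: AroraBarakCC2009, Thm. 5.4] -/
theorem noPolyBoundedProofSystem_of_SigmaP_ne_NP {k : ℕ} (hk : 1 ≤ k)
    (h : SigmaP k ≠ Nondeterministic.NP) : ExpanderLinearGenerators.NoPolyBoundedProofSystem :=
  noPolyBoundedProofSystem_of_NP_ne_coNP (NP_ne_coNP_of_SigmaP_ne_NP hk h)

/-- If some level `Πₖᵖ` (`k ≥ 1`) of the polynomial hierarchy differs from `NP`, the target holds.
[cite: AroraBarakCC2009, Thm. 5.4] -/
theorem noPolyBoundedProofSystem_of_PiP_ne_NP {k : ℕ} (hk : 1 ≤ k)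
    (h : PiP k ≠ Nondeterministic.NP) : ExpanderLinearGenerators.NoPolyBoundedProofSystem :=
  noPolyBoundedProofSystem_of_NP_ne_coNP (NP_ne_coNP_of_PiP_ne_NP hk h)

/-- The most quoted instance: `Σ₂ᵖ ≠ NP` implies the target. [cite: AroraBarakCC2009, Thm. 5.4] -/
theorem noPolyBoundedProofSystem_of_SigmaP_two_ne_NP (h : SigmaP 2 ≠ Nondeterministic.NP) :
    ExpanderLinearGenerators.NoPolyBoundedProofSystem :=
  noPolyBoundedProofSystem_of_SigmaP_ne_NP (by norm_num) h

/-- Any separation of a level `Σₖᵖ` from `Πₖᵖ` (`k ≥ 1`) implies the target: under `NP = coNP`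
both equal `NP`. [cite: AroraBarakCC2009, Thm. 5.4] -/
theorem noPolyBoundedProofSystem_of_SigmaP_ne_PiP {k : ℕ} (hk : 1 ≤ k) (h : SigmaP k ≠ PiP k) :
    ExpanderLinearGenerators.NoPolyBoundedProofSystem := by
  by_contra hX
  have heq : Nondeterministic.NP = coNP := by
    by_contra hne
    exact hX (noPolyBoundedProofSystem_of_NP_ne_coNP hne)
  have hS : SigmaP k = Nondeterministic.NP := by
    by_contra hne
    exact NP_ne_coNP_of_SigmaP_ne_NP hk hne heq
  have hP : PiP k = Nondeterministic.NP := by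
    by_contra hne
    exact NP_ne_coNP_of_PiP_ne_NP hk hne heq
  exact h (hS.trans hP.symm)

/-- If `PH` differs from some level `Σₖᵖ` with `k ≥ 1` (the hierarchy does not collapse to that
level), the target holds: under `NP = coNP`, `PH = NP = Σₖᵖ`. [cite: AroraBarakCC2009, Thm. 5.4] -/
theorem noPolyBoundedProofSystem_of_PH_ne_SigmaP {k : ℕ} (hk : 1 ≤ k) (h : PH ≠ SigmaP k) :
    ExpanderLinearGenerators.NoPolyBoundedProofSystem := by
  by_contra hX
  have heq : Nondeterministic.NP = coNP := by
    by_contra hne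
    exact hX (noPolyBoundedProofSystem_of_NP_ne_coNP hne)
  have hS : SigmaP k = Nondeterministic.NP := by
    by_contra hne
    exact NP_ne_coNP_of_SigmaP_ne_NP hk hne heq
  exact h ((PH_eq_NP_of_NP_eq_coNP heq).trans hS.symm)

/-- **Crux #2 of route ProofCplx in Krajíček's "hard for all proof systems" form** (Lemma 19.4.1,
language level, tree: `range_hits_NP_iff_finite_short_proofs`): `ProofcplxKrajicekGenerator` iff
some `g ∈ FP` with `|g x| = |x| + 1` is such that every polynomial-time verifier sound for
`(rng g)ᶜ` proves, within any polynomial length bound, only finitely many strings.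
[cite: KrajicekProofComplexity2019, Lemma 19.4.1] -/
theorem proofcplxKrajicekGenerator_iff_hard_for_all_proofSystems :
    ProofCplx.ProofcplxKrajicekGenerator ↔
      ∃ g : List Bool → List Bool, g ∈ FP ∧ (∀ x, (g x).length = x.length + 1) ∧
        ∀ V : List Bool → List Bool → Bool, IsPolyTimeVerifier V →
          (∀ b π, V b π = true → b ∉ Set.range g) → ∀ p : Polynomial ℕ,
            ({b | ∃ π : List Bool, π.length ≤ p.eval b.length ∧ V b π = true} :
              Set (List Bool)).Finite := by
  unfold ProofCplx.ProofcplxKrajicekGenerator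
  refine exists_congr fun g => and_congr_right fun _ => and_congr_right fun _ => ?_
  exact range_hits_NP_iff_finite_short_proofs g

/-- Hence a polynomial-time one-bit-stretching map that is hard for all proof systems (in the
sense above) gives the target. [cite: KrajicekProofComplexity2019, Lemma 19.4.1] -/
theorem noPolyBoundedProofSystem_of_hard_for_all_proofSystems {g : List Bool → List Bool}
    (hg : g ∈ FP) (hlen : ∀ x, (g x).length = x.length + 1)
    (hhard : ∀ V : List Bool → List Bool → Bool, IsPolyTimeVerifier V →
      (∀ b π, V b π = true → b ∉ Set.range g) → ∀ p : Polynomial ℕ,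
        ({b | ∃ π : List Bool, π.length ≤ p.eval b.length ∧ V b π = true} :
          Set (List Bool)).Finite) :
    ExpanderLinearGenerators.NoPolyBoundedProofSystem :=
  noPolyBoundedProofSystem_of_stretching_generator hg hlen (range_hits_NP_of_finite_short_proofs hhard)

/-! ### Consequences of `X` (and of `¬X`) -/

/-- The negation of the target collapses the polynomial hierarchy to `NP`: a polynomially bounded
proof system for `TAUT` gives `NP = coNP` (Cook–Reckhow) and hence `PH = NP` (Stockmeyer).
[cite: AroraBarakCC2009, Thm. 5.4] -/
theorem PH_eq_NP_of_not_noPolyBoundedProofSystem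
    (h : ¬ ExpanderLinearGenerators.NoPolyBoundedProofSystem) : PH = Nondeterministic.NP := by
  apply PH_eq_NP_of_NP_eq_coNP
  by_contra hne
  exact h (noPolyBoundedProofSystem_of_NP_ne_coNP hne)

/-- **The target implies crux #3 of route ProofCplx** (super-polynomial Frege lower bounds,
`ProofcplxFregeNotPbounded`, stmt-PneNP-0112): a polynomially bounded Frege system would give
`NP = coNP` (Cook–Reckhow 1979, Prop. 1.1 with Cor. 2.4; tree: `NP_eq_coNP_of_isPolyBounded_holds`,
which rests on the formalised polynomial-time Frege proof checker), contradicting the target.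
[cite: CookReckhow1979, §1–2 (Prop. 1.1, Cor. 2.4)] -/
theorem proofcplxFregeNotPbounded_of_noPolyBoundedProofSystem
    (hX : ExpanderLinearGenerators.NoPolyBoundedProofSystem) : ProofCplx.ProofcplxFregeNotPbounded := by
  unfold ProofCplx.ProofcplxFregeNotPbounded
  intro F hF hPB
  exact noPolyBoundedProofSystem_iff_NP_ne_coNP.1 hX (NP_eq_coNP_of_isPolyBounded_holds hF hPB)

/-- In particular the target implies that the tree's textbook Frege system `textbookFrege` is not
polynomially bounded (it is a Frege system: `isFrege_textbookFrege_holds`).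
[cite: CookReckhow1979, §1–2 (Prop. 1.1, Cor. 2.4)] -/
theorem not_isPolyBounded_textbookFrege_of_noPolyBoundedProofSystem
    (hX : ExpanderLinearGenerators.NoPolyBoundedProofSystem) : ¬ textbookFrege.IsPolyBounded :=
  proofcplxFregeNotPbounded_of_noPolyBoundedProofSystem hX textbookFrege isFrege_textbookFrege_holds

/-- The target implies the summit statement `PneNP` (the proved bridge `tautBridge_proof`).
[cite: CookReckhow1979, §1 Prop. 1.1] -/
theorem pneNP_of_noPolyBoundedProofSystem (hX : ExpanderLinearGenerators.NoPolyBoundedProofSystem) :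
    _root_.PneNP :=
  tautBridge_proof hX

/-! ### The ProofCplx ladder, composed -/

/-- Crux #2 ⇒ crux #3 of route ProofCplx: Krajíček's generator conjecture implies super-polynomial
Frege lower bounds. [cite: Krajicek2022, §1 (p. 4)] -/
theorem proofcplxFregeNotPbounded_of_krajicekGenerator (h : ProofCplx.ProofcplxKrajicekGenerator) :
    ProofCplx.ProofcplxFregeNotPbounded :=
  proofcplxFregeNotPbounded_of_noPolyBoundedProofSystem (noPolyBoundedProofSystem_of_krajicekGenerator h)

/-- Crux #2 of route ProofCplx already yields the summit statement `PneNP`.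
[cite: Krajicek2022, §1 (p. 4)] -/
theorem pneNP_of_krajicekGenerator (h : ProofCplx.ProofcplxKrajicekGenerator) : _root_.PneNP :=
  pneNP_of_noPolyBoundedProofSystem (noPolyBoundedProofSystem_of_krajicekGenerator h)

/-- Non-collapse `PH ≠ NP` already yields the summit statement `PneNP` (through the target).
[cite: AroraBarakCC2009, Thm. 5.4] -/
theorem pneNP_of_PH_ne_NP (h : PH ≠ Nondeterministic.NP) : _root_.PneNP :=
  pneNP_of_noPolyBoundedProofSystem (noPolyBoundedProofSystem_of_PH_ne_NP h)

/-- The target of this route is literally the thesis of route ProofCplx (`ProofcplxThesis`, the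
same item stmt-PneNP-0097). [folklore] -/
theorem noPolyBoundedProofSystem_iff_proofcplxThesis :
    ExpanderLinearGenerators.NoPolyBoundedProofSystem ↔ ProofCplx.ProofcplxThesis :=
  Iff.rfl

/-! ### Equivalent forms of `X` -/

/-- `coNP ⊆ NP` already forces `NP = coNP` (complementation: `L ∈ NP ⇒ Lᶜ ∈ coNP ⊆ NP ⇒ L ∈ coNP`).
[folklore] -/
theorem NP_eq_coNP_of_coNP_subset_NP (h : coNP ⊆ Nondeterministic.NP) : Nondeterministic.NP = coNP := by
  refine Set.Subset.antisymm (fun L hL => ?_) h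
  have hc : Lᶜ ∈ coNP := by
    show Lᶜᶜ ∈ Nondeterministic.NP
    rwa [compl_compl]
  exact h hc

/-- `NP ⊆ coNP` already forces `NP = coNP` (complementation). [folklore] -/
theorem NP_eq_coNP_of_NP_subset_coNP (h : Nondeterministic.NP ⊆ coNP) : Nondeterministic.NP = coNP := by
  refine Set.Subset.antisymm h (fun L hL => ?_)
  have hc : Lᶜ ∈ Nondeterministic.NP := hL
  have hcc : Lᶜᶜ ∈ Nondeterministic.NP := h hc
  rwa [compl_compl] at hcc

/-- **Form 1.** The target iff `coNP ⊄ NP`. [cite: CookReckhow1979, §1 Prop. 1.1] -/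
theorem noPolyBoundedProofSystem_iff_not_coNP_subset_NP :
    ExpanderLinearGenerators.NoPolyBoundedProofSystem ↔ ¬ coNP ⊆ Nondeterministic.NP := by
  rw [noPolyBoundedProofSystem_iff_NP_ne_coNP]
  exact ⟨fun h hsub => h (NP_eq_coNP_of_coNP_subset_NP hsub), fun h heq => h heq.symm.subset⟩

/-- **Form 2.** The target iff `NP ⊄ coNP`. [cite: CookReckhow1979, §1 Prop. 1.1] -/
theorem noPolyBoundedProofSystem_iff_not_NP_subset_coNP :
    ExpanderLinearGenerators.NoPolyBoundedProofSystem ↔ ¬ Nondeterministic.NP ⊆ coNP := by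
  rw [noPolyBoundedProofSystem_iff_NP_ne_coNP]
  exact ⟨fun h hsub => h (NP_eq_coNP_of_NP_subset_coNP hsub), fun h heq => h heq.subset⟩

/-- **Form 3.** The target iff some `NP` language is outside `coNP`. [cite: CookReckhow1979, §1 Prop. 1.1] -/
theorem noPolyBoundedProofSystem_iff_exists_mem_NP_not_mem_coNP :
    ExpanderLinearGenerators.NoPolyBoundedProofSystem ↔ ∃ L ∈ Nondeterministic.NP, L ∉ coNP := by
  rw [noPolyBoundedProofSystem_iff_not_NP_subset_coNP, Set.not_subset]

/-- **Form 4 (`SAT`).** The target iff `SAT ∉ coNP`: by Cook–Levin (`SAT_isNPHard_holds`,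
`SAT_mem_NP_holds`) `SAT ∈ coNP` iff `NP ⊆ coNP` (preimages: `preimage_mem_NP`).
[cite: CookReckhow1979, §1 Prop. 1.1] -/
theorem noPolyBoundedProofSystem_iff_SAT_not_mem_coNP :
    ExpanderLinearGenerators.NoPolyBoundedProofSystem ↔ SAT ∉ coNP := by
  rw [noPolyBoundedProofSystem_iff_not_NP_subset_coNP]
  constructor
  · intro h hSAT
    apply h
    intro L hL
    obtain ⟨f, hf, hfL⟩ := SAT_isNPHard_holds L hL
    have hSATc : (SATᶜ : Language Bool) ∈ Nondeterministic.NP := hSAT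
    have hpre : f ⁻¹' (SATᶜ : Language Bool) ∈ Nondeterministic.NP := preimage_mem_NP hSATc hf
    have hLc : (Lᶜ : Language Bool) = f ⁻¹' (SATᶜ : Language Bool) := by
      ext x
      show x ∉ L ↔ f x ∉ SAT
      exact not_congr (hfL x)
    show Lᶜ ∈ Nondeterministic.NP
    rw [hLc]
    exact hpre
  · intro h hsub
    exact h (hsub SAT_mem_NP_holds)

/-- **Form 5 (proof complexity).** The target iff EVERY Cook–Reckhow proof system for `TAUT`
has a super-polynomially hard sequence of tautologies, i.e. none is polynomially bounded
(unfolding `HasPolyBoundedProofSystem`). [cite: CookReckhow1979, §1 (Def. of polynomially bounded)] -/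
theorem noPolyBoundedProofSystem_iff_forall_not_isPolyBounded :
    ExpanderLinearGenerators.NoPolyBoundedProofSystem ↔
      ∀ V, IsProofSystemFor V TAUT → ¬ IsPolyBounded V := by
  unfold ExpanderLinearGenerators.NoPolyBoundedProofSystem HasPolyBoundedProofSystem
  simp only [not_exists, not_and]

end Summit.PneNP.PneNP.Theorems
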